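import Literature.NumberTheory.GaloisRepresentations.IdeleSUnitsClassSequenceInflation
import HarnessLib

/-!
# Layer change for the WHOLE `S`-unit / `S`-idèle / idèle-class sequence: the pair morphisms of `J_{·,S}·ˣ/·ˣ` and of
# `Cl_S(·)` over `res : Gal(E'/F) ↠ Gal(E/F)`, the morphisms of short exact sequences (A), (B), the naturality of their
# connecting homomorphisms under inflation, and «capitulation ⟹ Inf = 0 on Hⁿ(·, Cl_S)»
# (Neukirch–Schmidt–Wingberg VIII §3 (8.3.9)–(8.3.11); Tate, C–F VII §11.1; Harari Lemma 15.39, Prop. 15.40 (a))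

Topic `NumberTheory/GaloisRepresentations`; namespace `Literature.NumberTheory.GaloisRepresentations.IdeleCohomology`,
continuing `IdeleSUnitsClassSequence.lean` (one layer: (A) `0 → 𝒪_{E,S}ˣ → J_{E,S} → J_{E,S}Eˣ/Eˣ → 0`, (B)
`0 → J_{E,S}Eˣ/Eˣ → C_E → Cl_S(E) → 0` as `sUnitsShortComplex S`, `sClassShortComplex S`) and
`IdeleSUnitsClassSequenceInflation.lean` (the pair morphisms `ideleSInflHom` of `J_{·,S}` and `sUnitsIdeleInflHom` of `𝒪ˣ_{·,S}`
over `res = AlgEquiv.restrictNormalHom E`).  Definitions with bodies (two pair morphisms, two morphisms of short complexes)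
and theorems; NO named fact, no `sorry`, no instance, no notation; number fields in `Type`.

Mathematics.  In a tower `F ⊆ E ⊆ E'` of number fields (`E/F` normal) the base change `C_E → C_{E'}` (the tree's
`classInflHom`) maps the image `J_{E,S}Eˣ/Eˣ` of the `S`-idèles into `J_{E',S}E'ˣ/E'ˣ` (because base change maps `J_{E,S}`
into `J_{E',S}`), hence induces pair morphisms `J_{E,S}Eˣ/Eˣ → J_{E',S}E'ˣ/E'ˣ` and `Cl_S(E) → Cl_S(E')` over `res`; together
with `𝒪ˣ_{E,S} → 𝒪ˣ_{E',S}` and `J_{E,S} → J_{E',S}` they form morphisms of the short exact sequences (A), (B) «over `res`»,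
so the connecting homomorphisms commute with inflation: `Inf ∘ δ = δ ∘ Inf` (naturality of the snake `δ` for the morphism of
short exact sequences of cochain complexes induced by a compatible pair — Mathlib `groupCohomology.δ_naturality` for the
same group, the tree's `δ_comp_map_res` along `res`).  If moreover every idèle of `E` becomes principal-times-`S`-idèle in `E'`
(CAPITULATION, `I_E ⊆ E'ˣ · J_{E',S}`: Harari Prop. 15.40 (a) via the principal ideal theorem; NSW (8.3.11): «`Cl_S(k_S) = 0`»),
then the pair morphism `Cl_S(E) → Cl_S(E')` is ZERO, so `Inf = 0` on `Hⁿ(·, Cl_S)`.  This is the second half of the finite-layer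
toolkit for NSW's computation of `Hⁱ(G_S, 𝒪_S^×)`: e.g. a class of `H²(Gal(E/F), 𝒪ˣ_{E,S})` that dies in `H²(Gal(E/F), J_{E,S})`
(`= δ_A δ_B s`, `s ∈ Cl_S(E)^G`) dies after inflation to a capitulating layer — the injectivity `H²(G_S, 𝒪_S^×) ↪ H²(G_S, I_S)`
of (8.3.11) (ii)/(iii) at finite layers (sequel file).

## What is formalised (`F E E' : Type`, `[Algebra E E'] [IsScalarTower F E E'] [Normal F E]`, `S : Finset`, `res = restrictNormalHom E`)

* §1 `ideleSClassInflHom F E E' S : Rep.res res (ideleSClassRep F E S) ⟶ ideleSClassRep F E' S` (pair morphism of `J_{·,S}·ˣ/·ˣ`),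
  squares `ideleSClassInflHom_comp_ι` (with `classInflHom`), `res_ideleSToIdeleSClass_comp_ideleSClassInflHom` (with `ideleSInflHom`).
* §2 `sClassGroupInflHom F E E' S : Rep.res res (sClassGroupRep F E S) ⟶ sClassGroupRep F E' S` (pair morphism of `Cl_S(·)`), square
  `res_sClassGroupπ_comp_sClassGroupInflHom`; **`sClassGroupInflHom_eq_zero_of_forall_mem_sup`** (capitulation ⟹ `= 0`).
* §3 the morphisms of short complexes `sUnitsShortComplexInflHom`, `sClassShortComplexInflHom`
  (from `(·).map (Rep.resFunctor res)` of the `E`-sequences to the `E'`-sequences).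
* §4 `Inf` on `Hⁿ` for the two new modules (`ideleSClassInf`, `sClassGroupInf`) and the δ-NATURALITY squares
  **`δ_sUnits_comp_sUnitsIdeleInf`** (`δ_A ≫ Inf_{𝒪ˣ} = Inf_{J_S·ˣ/·ˣ} ≫ δ_A'`), **`δ_sClass_comp_ideleSClassInf`**
  (`δ_B ≫ Inf_{J_S·ˣ/·ˣ} = Inf_{Cl_S} ≫ δ_B'`), element forms, and `sClassGroupInf_eq_zero_of_forall_mem_sup`.

## References
* J. Neukirch, A. Schmidt, K. Wingberg, *Cohomology of Number Fields*, 2nd ed. (2008), VIII §3, (8.3.9)–(8.3.11).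
  [NeukirchSchmidtWingberg2008]
* J. W. S. Cassels, A. Fröhlich (eds.), *Algebraic Number Theory* (1967), Ch. VII (J. Tate) §11.1 (the exact commutative diagram
  of a tower). [CasselsFrohlichANT1967]
* D. Harari, *Galois Cohomology and Class Field Theory*, Universitext, Springer (2020), Lemma 15.39, Prop. 15.40 (a), §17.4 (17.1).
  [Harari2020]
* K. S. Brown, *Cohomology of Groups*, GTM 87 (1982), III §8 (compatibility of long exact sequences with change of group).
  [Brown1982CohomologyGroups]
-/

noncomputable section

open NumberField IsDedekindDomain CategoryTheory CategoryTheory.Limits groupCohomology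
open Literature.NumberTheory.Automorphic

namespace Literature.NumberTheory.GaloisRepresentations

namespace IdeleCohomology

open Literature.Algebra.Homology

variable {F E E' : Type} [Field F] [NumberField F] [Field E] [NumberField E] [Field E'] [NumberField E']
  [Algebra F E] [Algebra E E'] [Algebra F E'] [IsScalarTower F E E'] [Normal F E]
variable (S : Finset (HeightOneSpectrum (𝓞 F)))

/-! ## §1. The pair morphism of `J_{·,S}·ˣ/·ˣ` -/

/-- Base change maps `J_{E,S}Eˣ/Eˣ` into `J_{E',S}E'ˣ/E'ˣ` (the class of an `S`-idèle goes to the class of its base change, an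
`S`-idèle). [cite: NeukirchSchmidtWingberg2008, VIII §3 (8.3.9)] -/
theorem classInflHom_hom_mem_ideleSClassSubmodule {y : (IdeleClassGroup.galoisRep F E).V}
    (hy : y ∈ ideleSClassSubmodule F E S) : (classInflHom F E E').hom y ∈ ideleSClassSubmodule F E' S := by
  obtain ⟨x, rfl⟩ := (mem_ideleSClassSubmodule_iff S y).1 hy
  refine (mem_ideleSClassSubmodule_iff S _).2 ⟨(ideleSInflHom F E E' S).hom x, ?_⟩
  exact (congrArg (fun φ => φ.hom x) (res_ideleSToClass_comp_classInflHom (F := F) (E := E) (E' := E') S)).symm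

variable (F E E') in
/-- **`J_{E,S}Eˣ/Eˣ → J_{E',S}E'ˣ/E'ˣ` as a morphism `Res_{res}(J_{E,S}Eˣ/Eˣ) ⟶ J_{E',S}E'ˣ/E'ˣ` of `Gal(E'/F)`-modules** (the restriction
of the idèle-class base change `classInflHom` to the images of the `S`-idèles). [cite: NeukirchSchmidtWingberg2008, VIII §3 (8.3.9)]
[cite: CasselsFrohlichANT1967, Ch. VII §11.1] -/
def ideleSClassInflHom : Rep.res (AlgEquiv.restrictNormalHom E) (ideleSClassRep F E S) ⟶ ideleSClassRep F E' S :=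
  Rep.ofHom (LinearMap.intertwiningMap_of_isIntertwiningMap
    (Rep.res (AlgEquiv.restrictNormalHom E) (ideleSClassRep F E S)).ρ (ideleSClassRep F E' S).ρ
    (LinearMap.codRestrict (ideleSClassSubmodule F E' S)
      ((classInflHom F E E').hom.toLinearMap ∘ₗ (ideleSClassSubmodule F E S).subtype)
      fun y => classInflHom_hom_mem_ideleSClassSubmodule S y.2)
    fun τ (y : ideleSClassSubmodule F E S) => Subtype.ext (Rep.hom_comm_apply (classInflHom F E E') τ y.1))

/-- Unfolding on values: `ideleSClassInflHom` is `classInflHom` on representatives. [cite: NeukirchSchmidtWingberg2008, VIII §3 (8.3.9)] -/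
theorem ideleSClassι_hom_ideleSClassInflHom_hom_apply (y : (Rep.res (AlgEquiv.restrictNormalHom E) (ideleSClassRep F E S)).V) :
    (ideleSClassι S).hom ((ideleSClassInflHom F E E' S).hom y) =
      (classInflHom F E E').hom ((ideleSClassι S).hom (show (ideleSClassRep F E S).V from y)) := rfl

/-- **The square `J_{E,S}Eˣ/Eˣ ↪ C_E`, `J_{E',S}E'ˣ/E'ˣ ↪ C_{E'}`** (with the tree's `classInflHom`).
[cite: CasselsFrohlichANT1967, Ch. VII §11.1] -/
theorem ideleSClassInflHom_comp_ι :
    ideleSClassInflHom F E E' S ≫ ideleSClassι S =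
      (Rep.resFunctor (AlgEquiv.restrictNormalHom E)).map (ideleSClassι S) ≫ classInflHom F E E' :=
  Rep.hom_ext (Representation.IntertwiningMap.ext (LinearMap.ext fun _ => rfl))

/-- **The square `J_{E,S} ↠ J_{E,S}Eˣ/Eˣ`, `J_{E',S} ↠ J_{E',S}E'ˣ/E'ˣ`** (with `ideleSInflHom`).
[cite: NeukirchSchmidtWingberg2008, VIII §3 (8.3.9)] -/
theorem res_ideleSToIdeleSClass_comp_ideleSClassInflHom :
    (Rep.resFunctor (AlgEquiv.restrictNormalHom E)).map (ideleSToIdeleSClass S) ≫ ideleSClassInflHom F E E' S =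
      ideleSInflHom F E E' S ≫ ideleSToIdeleSClass S :=
  Rep.hom_ext (Representation.IntertwiningMap.ext (LinearMap.ext fun x => Subtype.ext
    (congrArg (fun φ => φ.hom x) (res_ideleSToClass_comp_classInflHom (F := F) (E := E) (E' := E') S))))

/-! ## §2. The pair morphism of `Cl_S(·)` and capitulation -/

variable (F E E') in
/-- **`Cl_S(E) → Cl_S(E')` as a morphism `Res_{res}(Cl_S(E)) ⟶ Cl_S(E')` of `Gal(E'/F)`-modules** (the quotient of `classInflHom`;
Mathlib `Submodule.mapQ`). [cite: NeukirchSchmidtWingberg2008, VIII §3 (8.3.9)][cite: Harari2020, Lemma 15.39] -/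
def sClassGroupInflHom : Rep.res (AlgEquiv.restrictNormalHom E) (sClassGroupRep F E S) ⟶ sClassGroupRep F E' S :=
  Rep.ofHom (LinearMap.intertwiningMap_of_isIntertwiningMap
    (Rep.res (AlgEquiv.restrictNormalHom E) (sClassGroupRep F E S)).ρ (sClassGroupRep F E' S).ρ
    ((ideleSClassSubmodule F E S).mapQ (ideleSClassSubmodule F E' S) (classInflHom F E E').hom.toLinearMap
      fun y hy => classInflHom_hom_mem_ideleSClassSubmodule S hy)
    fun τ q => by
      induction q using Submodule.Quotient.induction_on with
      | H y =>
        exact congrArg (Submodule.Quotient.mk (p := ideleSClassSubmodule F E' S))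
          (Rep.hom_comm_apply (classInflHom F E E') τ y))

/-- **The square `C_E ↠ Cl_S(E)`, `C_{E'} ↠ Cl_S(E')`.** [cite: NeukirchSchmidtWingberg2008, VIII §3 (8.3.9)] -/
theorem res_sClassGroupπ_comp_sClassGroupInflHom :
    (Rep.resFunctor (AlgEquiv.restrictNormalHom E)).map (sClassGroupπ S) ≫ sClassGroupInflHom F E E' S =
      classInflHom F E E' ≫ sClassGroupπ S :=
  Rep.hom_ext (Representation.IntertwiningMap.ext (LinearMap.ext fun _ => rfl))

/-- `Res(J_{E,S}Eˣ/Eˣ ↪ C_E) ≫ (C_E → C_{E'}) ≫ (C_{E'} ↠ Cl_S(E'))` is zero. [cite: NeukirchSchmidtWingberg2008, VIII §3 (8.3.9)] -/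
theorem res_ideleSClassι_comp_classInflHom_comp_sClassGroupπ :
    (Rep.resFunctor (AlgEquiv.restrictNormalHom E)).map (ideleSClassι S) ≫ classInflHom F E E' ≫ sClassGroupπ S = 0 := by
  rw [← Category.assoc, ← ideleSClassInflHom_comp_ι, Category.assoc, ideleSClassι_comp_sClassGroupπ, comp_zero]

/-- **CAPITULATION ⟹ the pair morphism `Cl_S(E) → Cl_S(E')` is ZERO**: if the base change of every idèle of `E` lies in
`E'ˣ · J_{E',S}` (Harari Prop. 15.40 (a): the principal ideal theorem in `K_S`; NSW: «`Cl_S(k_S) = 0`»), every class of `Cl_S(E)` dies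
in `Cl_S(E')`. [cite: Harari2020, Prop. 15.40 (a), Thm. 15.31][cite: NeukirchSchmidtWingberg2008, VIII §3 (8.3.11) (proof)] -/
theorem sClassGroupInflHom_eq_zero_of_forall_mem_sup
    (hcap : ∀ x : ideleGroup E, AdeleRing.ideleBaseChange E E' x ∈ principalIdeles E' ⊔ ideleS F E' S) :
    sClassGroupInflHom F E E' S = 0 := by
  refine Rep.hom_ext (Representation.IntertwiningMap.ext (LinearMap.ext fun q => ?_))
  induction q using Submodule.Quotient.induction_on with
  | H y =>
    -- the class `[y] ∈ Cl_S(E)` goes to `[y_{E'}] ∈ Cl_S(E')`, which vanishes iff `y_{E'}` is represented by an `S`-idèle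
    change (sClassGroupπ S).hom ((classInflHom F E E').hom y) = 0
    rw [sClassGroupπ_hom_apply_eq_zero_iff]
    -- `y = [x]`; `x_{E'} = a · j` with `a` principal and `j` an `S`-idèle, so `[x_{E'}] = [j]`
    obtain ⟨x, hx⟩ := QuotientGroup.mk_surjective (Additive.toMul (α := IdeleClassGroup E) y)
    obtain ⟨a, ha, j, hj, haj⟩ := Subgroup.mem_sup.1 (hcap x)
    refine ⟨⟨j, hj⟩, ?_⟩
    rw [classInflHom_hom_apply, ← hx, classBaseChange_mk, ← haj]
    change ((j : IdeleClassGroup E')) = ((a * j : ideleGroup E') : IdeleClassGroup E')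
    exact QuotientGroup.eq.2 (by rwa [mul_comm a j, inv_mul_cancel_left])

/-! ## §3. The morphisms of the short exact sequences (A), (B) over `res` -/

variable (F E E') in
/-- **The morphism of short complexes (A)**: `Res_{res}(𝒪ˣ_{E,S} → J_{E,S} → J_{E,S}Eˣ/Eˣ) ⟶ (𝒪ˣ_{E',S} → J_{E',S} → J_{E',S}E'ˣ/E'ˣ)`.
[cite: CasselsFrohlichANT1967, Ch. VII §11.1][cite: NeukirchSchmidtWingberg2008, VIII §3 (8.3.9)] -/
def sUnitsShortComplexInflHom :
    (sUnitsShortComplex (F := F) (E := E) S).map (Rep.resFunctor (AlgEquiv.restrictNormalHom E)) ⟶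
      sUnitsShortComplex (F := F) (E := E') S where
  τ₁ := sUnitsIdeleInflHom F E E' S
  τ₂ := ideleSInflHom F E E' S
  τ₃ := ideleSClassInflHom F E E' S
  comm₁₂ := sUnitsIdeleInflHom_comp_ι S
  comm₂₃ := (res_ideleSToIdeleSClass_comp_ideleSClassInflHom S).symm

variable (F E E') in
/-- **The morphism of short complexes (B)**: `Res_{res}(J_{E,S}Eˣ/Eˣ → C_E → Cl_S(E)) ⟶ (J_{E',S}E'ˣ/E'ˣ → C_{E'} → Cl_S(E'))`.
[cite: CasselsFrohlichANT1967, Ch. VII §11.1][cite: NeukirchSchmidtWingberg2008, VIII §3 (8.3.9)] -/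
def sClassShortComplexInflHom :
    (sClassShortComplex (F := F) (E := E) S).map (Rep.resFunctor (AlgEquiv.restrictNormalHom E)) ⟶
      sClassShortComplex (F := F) (E := E') S where
  τ₁ := ideleSClassInflHom F E E' S
  τ₂ := classInflHom F E E'
  τ₃ := sClassGroupInflHom F E E' S
  comm₁₂ := ideleSClassInflHom_comp_ι S
  comm₂₃ := (res_sClassGroupπ_comp_sClassGroupInflHom S).symm

/-! ## §4. `Inf` on `Hⁿ` for the two new modules and the naturality of the connecting homomorphisms -/

variable (F E E') in
/-- **`Inf : Hⁿ(Gal(E/F), J_{E,S}Eˣ/Eˣ) → Hⁿ(Gal(E'/F), J_{E',S}E'ˣ/E'ˣ)`.** [cite: NeukirchSchmidtWingberg2008, VIII §3 (8.3.11)] -/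
def ideleSClassInf (n : ℕ) : groupCohomology (ideleSClassRep F E S) n ⟶ groupCohomology (ideleSClassRep F E' S) n :=
  groupCohomology.map (AlgEquiv.restrictNormalHom E) (ideleSClassInflHom F E E' S) n

variable (F E E') in
/-- **`Inf : Hⁿ(Gal(E/F), Cl_S(E)) → Hⁿ(Gal(E'/F), Cl_S(E'))`.** [cite: NeukirchSchmidtWingberg2008, VIII §3 (8.3.11)] -/
def sClassGroupInf (n : ℕ) : groupCohomology (sClassGroupRep F E S) n ⟶ groupCohomology (sClassGroupRep F E' S) n :=
  groupCohomology.map (AlgEquiv.restrictNormalHom E) (sClassGroupInflHom F E E' S) n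

/-- `Hⁿ(res, 0) = 0`. [cite: Brown1982CohomologyGroups, III §8] -/
private theorem map_res_zero {G H : Type} [Group G] [Group H] (f : H →* G) (X : Rep ℤ G) (Y : Rep ℤ H) (n : ℕ) :
    groupCohomology.map f (0 : Rep.res f X ⟶ Y) n = 0 := by
  change HomologicalComplex.homologyMap (cochainsMap f (0 : Rep.res f X ⟶ Y)) n = 0
  rw [cochainsMap_zero, HomologicalComplex.homologyMap_zero]

/-- **CAPITULATION ⟹ `Inf = 0` on `Hⁿ(·, Cl_S)`.** [cite: NeukirchSchmidtWingberg2008, VIII §3 (8.3.11) (proof)][cite: Harari2020, Prop. 15.40 (a)] -/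
theorem sClassGroupInf_eq_zero_of_forall_mem_sup
    (hcap : ∀ x : ideleGroup E, AdeleRing.ideleBaseChange E E' x ∈ principalIdeles E' ⊔ ideleS F E' S) (n : ℕ) :
    sClassGroupInf F E E' S n = 0 := by
  rw [sClassGroupInf, sClassGroupInflHom_eq_zero_of_forall_mem_sup S hcap]
  exact map_res_zero _ _ _ n

/-! ### Naturality of `δ` for a morphism of short exact sequences over a group homomorphism

For `f : H → G`, short exact `X` over `G`, `Y` over `H` and a morphism `Φ : Res_f(X) ⟶ Y` of short complexes, the
connecting homomorphisms satisfy `δ_X ≫ Hʲ(f, Φ₁) = Hⁱ(f, Φ₃) ≫ δ_Y`: factor `Hⁿ(f, Φ_m) = Hⁿ(f, 𝟙) ≫ Hⁿ(id, Φ_m)` and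
combine «`δ` commutes with `Hⁿ(f, 𝟙)`» (the tree's `Literature.Algebra.Homology.δ_comp_map_res`, restated privately so
that this file's imports stay inside the idèle-cohomology corner) with Mathlib's `groupCohomology.δ_naturality`. -/

/-- `Hⁿ(f, Φ₁) = Hⁿ(f, 𝟙) ≫ Hⁿ(id, Φ₁)`. [cite: Brown1982CohomologyGroups, III §8] -/
private theorem map_τ₁_fac {G H : Type} [Group G] [Group H] (f : H →* G) {X : ShortComplex (Rep ℤ G)}
    {Y : ShortComplex (Rep ℤ H)} (Φ : X.map (Rep.resFunctor f) ⟶ Y) (n : ℕ) :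
    groupCohomology.map f (A := X.X₁) (B := Y.X₁) Φ.τ₁ n =
      groupCohomology.map f (𝟙 ((X.map (Rep.resFunctor f)).X₁)) n ≫ groupCohomology.map (MonoidHom.id H) Φ.τ₁ n := by
  rw [← groupCohomology.map_comp]
  exact map_congr' (MonoidHom.comp_id f).symm _ _ (fun _ => rfl) n

/-- `Hⁿ(f, Φ₃) = Hⁿ(f, 𝟙) ≫ Hⁿ(id, Φ₃)`. [cite: Brown1982CohomologyGroups, III §8] -/
private theorem map_τ₃_fac {G H : Type} [Group G] [Group H] (f : H →* G) {X : ShortComplex (Rep ℤ G)}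
    {Y : ShortComplex (Rep ℤ H)} (Φ : X.map (Rep.resFunctor f) ⟶ Y) (n : ℕ) :
    groupCohomology.map f (A := X.X₃) (B := Y.X₃) Φ.τ₃ n =
      groupCohomology.map f (𝟙 ((X.map (Rep.resFunctor f)).X₃)) n ≫ groupCohomology.map (MonoidHom.id H) Φ.τ₃ n := by
  rw [← groupCohomology.map_comp]
  exact map_congr' (MonoidHom.comp_id f).symm _ _ (fun _ => rfl) n

/-- `δ` commutes with `Hⁿ(f, 𝟙)` (the tree's `Literature.Algebra.Homology.δ_comp_map_res`).
[cite: Brown1982CohomologyGroups, III §8] -/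
private theorem δ_comp_map_res' {G H : Type} [Group G] [Group H] (f : H →* G)
    {X : ShortComplex (Rep ℤ G)} (hX : X.ShortExact) (hres : (X.map (Rep.resFunctor f)).ShortExact)
    (i j : ℕ) (hij : i + 1 = j) :
    groupCohomology.δ hX i j hij ≫ groupCohomology.map f (𝟙 ((X.map (Rep.resFunctor f)).X₁)) j =
      groupCohomology.map f (𝟙 ((X.map (Rep.resFunctor f)).X₃)) i ≫ groupCohomology.δ hres i j hij := by
  let Φ : X.map (cochainsFunctor ℤ G) ⟶ (X.map (Rep.resFunctor f)).map (cochainsFunctor ℤ H) :=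
    { τ₁ := cochainsMap f (𝟙 ((X.map (Rep.resFunctor f)).X₁))
      τ₂ := cochainsMap f (𝟙 ((X.map (Rep.resFunctor f)).X₂))
      τ₃ := cochainsMap f (𝟙 ((X.map (Rep.resFunctor f)).X₃))
      comm₁₂ := rfl
      comm₂₃ := rfl }
  exact HomologicalComplex.HomologySequence.δ_naturality Φ (map_cochainsFunctor_shortExact hX)
    (map_cochainsFunctor_shortExact hres) i j hij

/-- **`δ_X ≫ Hʲ(f, Φ₁) = Hⁱ(f, Φ₃) ≫ δ_Y`** for a morphism `Φ : Res_f(X) ⟶ Y` of short exact sequences of representations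
over `f : H → G`. [cite: Brown1982CohomologyGroups, III §8] -/
private theorem δ_comp_map_of_hom {G H : Type} [Group G] [Group H] (f : H →* G)
    {X : ShortComplex (Rep ℤ G)} {Y : ShortComplex (Rep ℤ H)} (hX : X.ShortExact) (hY : Y.ShortExact)
    (Φ : X.map (Rep.resFunctor f) ⟶ Y) (i j : ℕ) (hij : i + 1 = j) :
    groupCohomology.δ hX i j hij ≫ groupCohomology.map f (A := X.X₁) (B := Y.X₁) Φ.τ₁ j =
      groupCohomology.map f (A := X.X₃) (B := Y.X₃) Φ.τ₃ i ≫ groupCohomology.δ hY i j hij := by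
  have hres : (X.map (Rep.resFunctor f)).ShortExact := (Rep.shortExact_res f).2 hX
  have h1 := δ_comp_map_res' f hX hres i j hij
  have h2 := groupCohomology.δ_naturality hres hY Φ i j hij
  rw [map_τ₁_fac f Φ j, map_τ₃_fac f Φ i, ← Category.assoc, h1, Category.assoc, h2, Category.assoc]

/-- **Naturality of `δ_A` under inflation**: `δ_A ≫ Inf_{𝒪ˣ_S} = Inf_{J_S·ˣ/·ˣ} ≫ δ_A'` (`Hⁱ(Gal(E/F), J_{E,S}Eˣ/Eˣ) → Hʲ(Gal(E'/F), 𝒪ˣ_{E',S})`).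
[cite: Brown1982CohomologyGroups, III §8][cite: CasselsFrohlichANT1967, Ch. VII §11.1] -/
theorem δ_sUnits_comp_sUnitsIdeleInf (i j : ℕ) (hij : i + 1 = j) :
    groupCohomology.δ (sUnitsShortComplex_shortExact (F := F) (E := E) S) i j hij ≫ sUnitsIdeleInf F E E' S j =
      ideleSClassInf F E E' S i ≫ groupCohomology.δ (sUnitsShortComplex_shortExact (F := F) (E := E') S) i j hij :=
  δ_comp_map_of_hom (AlgEquiv.restrictNormalHom (K₁ := E') E) (sUnitsShortComplex_shortExact (F := F) (E := E) S)
    (sUnitsShortComplex_shortExact (F := F) (E := E') S) (sUnitsShortComplexInflHom F E E' S) i j hij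

/-- **Naturality of `δ_B` under inflation**: `δ_B ≫ Inf_{J_S·ˣ/·ˣ} = Inf_{Cl_S} ≫ δ_B'` (`Hⁱ(Gal(E/F), Cl_S(E)) → Hʲ(Gal(E'/F), J_{E',S}E'ˣ/E'ˣ)`).
[cite: Brown1982CohomologyGroups, III §8][cite: CasselsFrohlichANT1967, Ch. VII §11.1] -/
theorem δ_sClass_comp_ideleSClassInf (i j : ℕ) (hij : i + 1 = j) :
    groupCohomology.δ (sClassShortComplex_shortExact (F := F) (E := E) S) i j hij ≫ ideleSClassInf F E E' S j =
      sClassGroupInf F E E' S i ≫ groupCohomology.δ (sClassShortComplex_shortExact (F := F) (E := E') S) i j hij :=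
  δ_comp_map_of_hom (AlgEquiv.restrictNormalHom (K₁ := E') E) (sClassShortComplex_shortExact (F := F) (E := E) S)
    (sClassShortComplex_shortExact (F := F) (E := E') S) (sClassShortComplexInflHom F E E' S) i j hij

/-- Element form of `δ_sUnits_comp_sUnitsIdeleInf`. [cite: Brown1982CohomologyGroups, III §8] -/
theorem sUnitsIdeleInf_δ_apply (i j : ℕ) (hij : i + 1 = j) (t : groupCohomology (ideleSClassRep F E S) i) :
    sUnitsIdeleInf F E E' S j (groupCohomology.δ (sUnitsShortComplex_shortExact (F := F) (E := E) S) i j hij t) =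
      groupCohomology.δ (sUnitsShortComplex_shortExact (F := F) (E := E') S) i j hij (ideleSClassInf F E E' S i t) :=
  congrArg (fun φ : groupCohomology (ideleSClassRep F E S) i ⟶ groupCohomology (sUnitsIdeleRep F E' S) j => φ t)
    (δ_sUnits_comp_sUnitsIdeleInf (F := F) (E := E) (E' := E') S i j hij)

/-- Element form of `δ_sClass_comp_ideleSClassInf`. [cite: Brown1982CohomologyGroups, III §8] -/
theorem ideleSClassInf_δ_apply (i j : ℕ) (hij : i + 1 = j) (s : groupCohomology (sClassGroupRep F E S) i) :
    ideleSClassInf F E E' S j (groupCohomology.δ (sClassShortComplex_shortExact (F := F) (E := E) S) i j hij s) =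
      groupCohomology.δ (sClassShortComplex_shortExact (F := F) (E := E') S) i j hij (sClassGroupInf F E E' S i s) :=
  congrArg (fun φ : groupCohomology (sClassGroupRep F E S) i ⟶ groupCohomology (ideleSClassRep F E' S) j => φ s)
    (δ_sClass_comp_ideleSClassInf (F := F) (E := E) (E' := E') S i j hij)

end IdeleCohomology

end Literature.NumberTheory.GaloisRepresentations

end
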